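import Summits.QuantumFields.YangMills.Theorems.UnitScaleTiltProp7StubEXOfChartPiecesTwSR
import Summits.QuantumFields.YangMills.Theorems.UnitScaleTiltProp7StubEXOfDisplayedRowsWWS
import Summits.QuantumFields.YangMills.Theorems.UnitScaleTiltProp7SolutionRealityRowS
import HarnessLib

/-!
# [v3.2ˢ SOCKET CURRENCY TWIN of ✓`Prop7StubEXOfChartPiecesTwS3`: the Theorem-2 socket reads `Thm2SetupSUAt (F.P K) 2 (K − n) (eta F n K) β₀ B₁ B₂ c₁ len (fun _ => True)` —
# the weakest currency both consumers need (✓`cov_of_thm2SetupSUAt`, ✓`thm2Based_of_thm2SetupSUAt`); ★★OWNER g27 ACK 55 (1), socket owner's word (T-b) 2026-08-28 12:46Z;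
# everything else below VERBATIM.]
# Route `UnitScaleTilt`, crux K1 child «MinimiserStabilityRegPr» (stmt-QuantumFields-19200), skeleton v10, stub `stub_existenceMinimalOrbit` (EX), route (α) — **THE EX KNIT AT THE
# CHART OF RECORD AND THE SYMMETRIC SLICE, v3.0ˢ: THE (γ)-GROWTH ROW RE-KNIT AT THE CRITICAL BACKGROUND AND THE REALITY ROW (R-A₁) FOLDED** (★★OWNER RULINGS №26 ∕ №26a ∕ №30 (3),
# 2026-08-28; v3.0ˢ pen = the knit lineage seat ym-ust-19200-w2 g4).  As ✓`Prop7StubEXOfChartPiecesTwSR.stubEX_of_chartPiecesTwSR` (v2.9ˢ, the knit of record) with TWO displayed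
# rows REPLACED: (1) `hGrowth` — the PINNED-HORN k-uniform relative Poincaré at the curved critical background (located un-suppliable: HGROWTH-PIN ★w4-19200 g4, RULING №25, ★p1 g12's
# numerics 11:14Z `lqP ≈ 2.2ε²` ℓ-independent) — by the reduction (141)–(142) AT THE CRITICAL BACKGROUND `W = (e^{iX}U₀)^u`: an OPAQUE slice letter `Tsl` (print's linear Landau
# slice `{QA′ = 0, RD*A′ = 0}` at `W` read through (47), sizes included), CHART_W `hChartW` (every admissible competitor `X′` is, in action, a chart point: `A(e^{iX′}U₀) = A(e^{iD}W)`,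
# `D ∈ Tsl L i W` Hermitian-traceless — [Balaban1985RegularSpaces] Thm 2 at `W`, (47), gauge invariance of (5)) and LOCMIN_W `hLocW` (`A(W) ≤ A(e^{iD}W)` on the slice — «A′ = 0 is
# a minimum of 𝒜(A′)»; the α-P lane's row: scale-aware TAYLOR ∧ EL_W (✓`Prop7Growth142T3ChartEL`, from the E–L clause) ∧ HESS_W′ ⟹ LOCMIN_W), window `ε₄ ≤ aW L`; (2) `hA₁R`
# («the solution of (111) is `𝔤`-valued») — by its SUPPLIER ✓`Prop7SolutionRealityRowS.hA₁R_of_letterReality`: the letter-reality rows (R-𝒢) `h𝒢R`, (R-W) `hWR` (N06 ∕ P4 class,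
# ym-inputs ∕ ★w4-20520 layer-0 programme + (Q-b) ★w5-20520 g5) and the three `L`-only windows `2B₀α ≤ r`, `4r ≤ a₃`, `16B₀C₄r ≤ 1`.

Cell `ym3-torus`, width seat `ym-ust-19200-w2` (gen 4; EX knit lineage).  THEOREMS ONLY (0 `def`, 0 `sorry`).  CONDITIONAL: this file does NOT close the stub — the remaining
inputs are displayed hypotheses with named suppliers; `--supports stmt-QuantumFields-19200 --as helper`, count-neutral.  YM₃ on T³ is a ladder rung (R3), not the Clay problem;
nothing here claims the stub, the crux, d = 4 or the mass gap.

THE PRINT.  [Balaban1985Variational] p. 299: *«To see that U_k is a minimum we apply the whole procedure with the configuration U_k instead of U₀ … ⟨δA′, J⟩ = 0 for all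
δA′ : QδA′ = 0, RD*δA′ = 0. (141) … 𝒜(A′) = A(U_k) + ½⟨A′, Δ₁A′⟩ + V(A′). (142) A second order differential at A′ = 0 is given by the quadratic form above, and it is
positive definite. Hence A′ = 0 is a minimum»*; Prop. 6 p. 295 and (51) p. 286 (reality of the solution of (111) from the reality of the letters).  EX DISPLAY after this file
(hypotheses, by name): constants `B₀ C₄ a₃ α r M aW c₀ cB BH ef ε′`; N06 ×2 `norm_G`∕`norm_H₁`; P4 `prop4`; (45)–(46)-twˢ `h46tw` (+ `H` real); (WF) `hWe`∕`hWε`; `hMe`; (W137)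
`hw137`; `hBH0`; (W47q)∕(W47R); `h102`∕`h129`; `h102L`∕`h129L`; `hrε`; (R-H₁) `hH₁R`; (R-𝒢) `h𝒢R`; (R-W) `hWR`; `hrα`∕`hr4`∕`hr16`; `hXtw‴` (XL: (112) ∘ (123)–(140) ∘ E–L);
`Tsl` + CHART_W `hChartW` + LOCMIN_W `hLocW`; T2 `hThm2`.  REMOVED relative to v2.9ˢ: `CP θ cS` + `hGrowth`; `hA₁R`.

WHAT IS PROVED (sorry-free, no definition).  ★★★ **`stubEX_of_chartPiecesTwS3`** — the REGISTERED text of `stub_existenceMinimalOrbit` (all `L > 1`, all `B₃ > 4`) from the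
displayed rows: ✓`Prop7StubEXOfDisplayedRowsWW.stubEX_of_displayedRows_wW` at `Lan := IsLandauPrintS (c₀ L) (cB L)`, the chart of record, `β := Λ_k`, `B := Bsym`, with (B20) and
CHART-112ˢ discharged exactly as in v2.9ˢ (✓`bound20_symLog_of_closeAvg`, ✓`chart47twS_of_regPr_eta`, ✓`exists_normS_of_regPr_of_size`, ✓`dbarTwS_window_of_regPr`,
✓`hChart_of_piecesTwG` ∘ ✓`hXtw_of_split_etaG` ∘ ✓`hXtw'_of_splitG` ∘ ✓`hXtw''_of_reality`, (R-B) ✓`bsym_isHermitian_trace_zero`) and (R-A₁) supplied by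
✓`hA₁R_of_letterReality`.

References: T. Bałaban, CMP 102 (1985) 277–309 [Balaban1985Variational]; CMP 99 (1985) 75–102 [Balaban1985RegularSpaces]; CMP 99 (1985) 389–434 [Balaban1985BackgroundPropagators];
CMP 98 (1985) 17–51 [Balaban1985Averaging] (loci in the theorem docstring).
-/

set_option autoImplicit false

noncomputable section

open scoped BigOperators Matrix.Norms.L2Operator Matrix

namespace Summit.QuantumFields.YangMills.Theorems.Prop7StubEXOfChartPiecesTwS3S

open NormedSpace
open Literature.MathematicalPhysics.QuantumFieldTheory.Balaban1983to89
open Literature.MathematicalPhysics.QuantumFieldTheory.Balaban1983to89.T3ContinuumYM3Torus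
open Literature.MathematicalPhysics.QuantumFieldTheory.Balaban1983to89.T3UnitLawDensityEML (ℰp)
open Literature.MathematicalPhysics.QuantumFieldTheory.Balaban1983to89.T3TiltDescent (descendTo)
open Literature.MathematicalPhysics.QuantumFieldTheory.Balaban1983to89.T3ConstrainedMinimiser (fibre)
open Literature.MathematicalPhysics.QuantumFieldTheory.Balaban1983to89.T3PrintedRegularMinimiser (RegPr regFibrePr)
open Literature.MathematicalPhysics.QuantumFieldTheory.Balaban1983to89.T3PrintedRegularOrbits (descTransf)
open Literature.MathematicalPhysics.QuantumFieldTheory.Balaban1983to89.T3PrintedMinimiserExistence (regPr_mono)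
open Literature.MathematicalPhysics.QuantumFieldTheory.Balaban1983to89.T3Thm1Carrier
open Literature.MathematicalPhysics.QuantumFieldTheory.Balaban1983to89.T3SectALandauChart (In19 emb15 CloseAvg eta)
open BlockAveragingEMLLinearisedBackground (pertVar)
open B9SectCLatticeCarrier (Bond)
open B10Eq27TorusAxialLog (unitsField toUField)
open B11Eq115Space (NegSup NegSize Space115 JetSup)
open B11Eq111FrakG (nabla115)
open B11Eq98CurrentSlot (Jcur)
open B11Prop3Model (Dfix)
open B13Contraction113 (QuadAnalytic)
open B8Thm2SetupTorus (Thm2SetupSUAt)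
open B7Prop2SpecialUnitary (specialUnitaryUnits)
open MatrixLog (mlog)
open Summit.QuantumFields.YangMills.Theorems.Prop7TPrint (nMax19 expHermField)
open Summit.QuantumFields.YangMills.Theorems.Prop7SPrint (AvgCondPrint AvgCondPrintS NormS IsLandauPrint IsLandauPrintS)
open Summit.QuantumFields.YangMills.Theorems.Prop7SectET3Transport (periodsT3 siteEquiv siteEquiv_shiftEquiv bgOfCfg bondEquiv)
open Summit.QuantumFields.YangMills.Theorems.Prop7SymAvgTwSym (dbarTwS QTwS CmapTwS Chart47T3twS)
open Summit.QuantumFields.YangMills.Theorems.Prop7Bound20SymLog (bound20_symLog_of_closeAvg)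
open Summit.QuantumFields.YangMills.Theorems.Prop7ChartPiecesTwG (hChart_of_piecesTwG hXtw_of_split_etaG hXtw'_of_splitG)
open Summit.QuantumFields.YangMills.Theorems.Prop7StubEXOfDisplayedRowsWWS (stubEX_of_displayedRows_wWS)
open Summit.QuantumFields.YangMills.Theorems.Prop7StubEXOfChartPiecesTwSR (bsym_isHermitian_trace_zero)
open Summit.QuantumFields.YangMills.Theorems.Prop7SolutionRealityRowS (hA₁R_of_letterReality)
open Summit.QuantumFields.YangMills.Theorems.Prop7DbarTwSymWindow (dbarTwS_window_of_regPr)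
open Summit.QuantumFields.YangMills.Theorems.Prop7CmapTwSymInputs (chart47twS_of_regPr_eta)
open Summit.QuantumFields.YangMills.Theorems.Prop7StubEXOfChartPiecesTwL (windows_of_admissible three_le_memberL)
open Summit.QuantumFields.YangMills.Theorems.Prop7StubEXOfChartPiecesTwS (windows_of_W)
open Summit.QuantumFields.YangMills.Theorems.Prop7SymSliceWitness (exists_normS_of_regPr_of_size)
open Summit.QuantumFields.YangMills.Theorems.Prop7DbarTwWindow (norm_smul_I_le_of_nMax19_lt)
open Summit.QuantumFields.YangMills.Theorems.Prop7B8Prop7Div (regPr_emb15_of_in19)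
open Summit.QuantumFields.YangMills.Theorems.Prop7PV3CDELogChart (in19_expHermField_of_nMax19_lt)
open Summit.QuantumFields.YangMills.Theorems.Prop7ChartRealityRowS (hXtw''_of_reality)

variable {L : ℕ}

/-! ## §1 The knit v3.0ˢ in `Thm2SetupSUAt` socket currency -/

set_option maxHeartbeats 400000 in -- HEARTBEAT BUDGET rule (cell README): the knit elaborates at the default 200k but not at 100k (window `linarith`s); line-neutral
/-- ★★★ **`stub_existenceMinimalOrbit`'s REGISTERED TEXT FROM THE PIECES OF THE CHART OF RECORD, v3.0ˢ — THE GROWTH ROW RE-KNIT AT THE CRITICAL BACKGROUND, (R-A₁) FOLDED**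
(★★OWNER RULINGS №26a ∕ №30 (3)): as ✓`stubEX_of_chartPiecesTwSR` (v2.9ˢ) but (1) `hGrowth` (and its constants `CP θ cS`) is REPLACED by the opaque slice `Tsl`, the window constant
`aW` and the two rows CHART_W `hChartW` (every admissible competitor of C-min's ball is, in action, a chart point `e^{iD}W` of the slice at `W = (e^{iX}U₀)^u` — Thm 2 + (47) +
(5)-invariance) and LOCMIN_W `hLocW` (`A(W) ≤ A(e^{iD}W)` on the slice — (141)–(142)), and (2) `hA₁R` is REPLACED by the letter-reality rows (R-𝒢) `h𝒢R`, (R-W) `hWR` and the windows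
`hrα`∕`hr4`∕`hr16`, discharged inside by ✓`Prop7SolutionRealityRowS.hA₁R_of_letterReality`.  Everything else VERBATIM v2.9ˢ.  CONDITIONAL — the stub is not closed.
[cite: Balaban1985Variational, Prop. 7 p.299, (141)-(142) p.299, (51) p.286, (47)–(49) p.285, (103) p.293, (111)–(112) p.294, Props 5–6 pp.294–296, (19)–(21) p.281; Balaban1985RegularSpaces, Thm 2 p.83, (1.37)–(1.38) p.82; Balaban1985BackgroundPropagators, Thm 3.12 p.420, (3.124) p.420] -/
theorem stubEX_of_chartPiecesTwS3S
    [hFL : ∀ F : T3Family, Fact (0 < (F.L : ℝ))] [hFη : ∀ (F : T3Family) (k : ℕ), Fact (0 < ((F.L : ℝ)⁻¹) ^ k)]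
    -- the constants, member-uniform at each `L` (print: «absolute constants depending on d and L only»)
    (B₀ C₄ a₃ α r M aW : ℕ → ℝ) (hB₀ : ∀ L, 1 < L → 0 < B₀ L) (hC₄ : ∀ L, 1 < L → 0 < C₄ L) (ha₃ : ∀ L, 1 < L → 0 < a₃ L)
    (hα : ∀ L, 1 < L → 0 < α L) (hr : ∀ L, 1 < L → 0 < r L) (hM : ∀ L, 1 < L → 0 < M L) (haW : ∀ L, 1 < L → 0 < aW L)
    -- the `L²` weights of the projected Landau condition (21)ˢ `IsLandauPrintS` (display place (d); print: `c₀ = η³`, `cB = 1`)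
    (c₀ cB : ℕ → ℝ) [hc₀ : ∀ L : ℕ, Fact (0 < c₀ L)]
    -- the curved letters `𝔊(U₀)`, `(δ/δA′)V`, `H₁(U₀)`, OPAQUE (the datum `B` is FIXED to `Bsym` on `Λ_k = PBond (P n) 0`)
    (𝒢f : ∀ (L : ℕ) (i : Idx L) (U₀ : GaugeField (i.1.1.P i.1.2.2) 0 (Matrix.specialUnitaryGroup (Fin 2) ℂ)),
      NegSize (i.1.1.L : ℝ) (((i.1.1.L : ℝ)⁻¹) ^ (i.1.2.2 - i.1.2.1)) (fun _ : Bond 3 (periodsT3 i.1.1 i.1.2.2) => i.1.2.2 - i.1.2.1) 3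
          (Matrix (Fin 2) (Fin 2) ℂ) →L[ℂ]
        Space115 (i.1.1.L : ℝ) (((i.1.1.L : ℝ)⁻¹) ^ (i.1.2.2 - i.1.2.1)) (fun _ : Bond 3 (periodsT3 i.1.1 i.1.2.2) => i.1.2.2 - i.1.2.1)
          (fun _ : Bond 3 (periodsT3 i.1.1 i.1.2.2) × Fin 3 => i.1.2.2 - i.1.2.1) (nabla115 (((i.1.1.L : ℝ)⁻¹) ^ (i.1.2.2 - i.1.2.1)) (bgOfCfg i.1.1 i.1.2.2 U₀)))
    (Wf : ∀ (L : ℕ) (i : Idx L) (U₀ : GaugeField (i.1.1.P i.1.2.2) 0 (Matrix.specialUnitaryGroup (Fin 2) ℂ)),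
      Space115 (i.1.1.L : ℝ) (((i.1.1.L : ℝ)⁻¹) ^ (i.1.2.2 - i.1.2.1)) (fun _ : Bond 3 (periodsT3 i.1.1 i.1.2.2) => i.1.2.2 - i.1.2.1)
          (fun _ : Bond 3 (periodsT3 i.1.1 i.1.2.2) × Fin 3 => i.1.2.2 - i.1.2.1) (nabla115 (((i.1.1.L : ℝ)⁻¹) ^ (i.1.2.2 - i.1.2.1)) (bgOfCfg i.1.1 i.1.2.2 U₀)) →
        NegSize (i.1.1.L : ℝ) (((i.1.1.L : ℝ)⁻¹) ^ (i.1.2.2 - i.1.2.1)) (fun _ : Bond 3 (periodsT3 i.1.1 i.1.2.2) => i.1.2.2 - i.1.2.1) 3 (Matrix (Fin 2) (Fin 2) ℂ))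
    (H₁f : ∀ (L : ℕ) (i : Idx L) (U₀ : GaugeField (i.1.1.P i.1.2.2) 0 (Matrix.specialUnitaryGroup (Fin 2) ℂ)),
      (PBond (i.1.1.P i.1.2.1) 0 → Matrix (Fin 2) (Fin 2) ℂ) →L[ℂ]
        Space115 (i.1.1.L : ℝ) (((i.1.1.L : ℝ)⁻¹) ^ (i.1.2.2 - i.1.2.1)) (fun _ : Bond 3 (periodsT3 i.1.1 i.1.2.2) => i.1.2.2 - i.1.2.1)
          (fun _ : Bond 3 (periodsT3 i.1.1 i.1.2.2) × Fin 3 => i.1.2.2 - i.1.2.1) (nabla115 (((i.1.1.L : ℝ)⁻¹) ^ (i.1.2.2 - i.1.2.1)) (bgOfCfg i.1.1 i.1.2.2 U₀)))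
    -- their displayed bounds (the `SectEDatum` fields at admissible backgrounds)
    (norm_G : ∀ (L : ℕ), 1 < L → ∀ (i : Idx L) (ρ : ℝ) (U₀ : GaugeField (i.1.1.P i.1.2.2) 0 (Matrix.specialUnitaryGroup (Fin 2) ℂ)),
      RegPr i.1.1 i.1.2.1 i.1.2.2 ρ U₀ → ρ ≤ α L → ∀ f, ‖𝒢f L i U₀ f‖ ≤ B₀ L * ‖f‖)
    (prop4 : ∀ (L : ℕ), 1 < L → ∀ (i : Idx L) (ρ : ℝ) (U₀ : GaugeField (i.1.1.P i.1.2.2) 0 (Matrix.specialUnitaryGroup (Fin 2) ℂ)),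
      RegPr i.1.1 i.1.2.1 i.1.2.2 ρ U₀ → ρ ≤ α L → QuadAnalytic (Wf L i U₀) (C₄ L) (a₃ L))
    (norm_H₁ : ∀ (L : ℕ), 1 < L → ∀ (i : Idx L) (ρ : ℝ) (U₀ : GaugeField (i.1.1.P i.1.2.2) 0 (Matrix.specialUnitaryGroup (Fin 2) ℂ)),
      RegPr i.1.1 i.1.2.1 i.1.2.2 ρ U₀ → ρ ≤ α L → ∀ b, ‖H₁f L i U₀ b‖ ≤ B₀ L * ‖b‖)
    -- (45)–(46)-twˢ AT ITS η-ORDER, against the chart of record `Q := QTwS U₀`, (45) in the projected form `IsLandauPrintS` (d): print's letter `H` — `QH = I`, `RD*H = 0` (45), `‖HY‖ ≤ B_H·η·‖Y‖` (46), η = L^{−(K−n)} (DISPLAYED; supplier of record: [Balaban1985BackgroundPropagators]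
    -- Thm 3.12 for `H` (3.126), (3.133) n = 0,1 ⊕ (2.61); T³ statement p607026 `normH₁_row_of_recordObligations` with `Hsel := Hk`; O(η) = pure scaling `H_route = η·H_print`)
    (BH : ℕ → ℝ)
    (h46tw : ∀ (L : ℕ), 1 < L → ∀ (i : Idx L) (U₀ : GaugeField (i.1.1.P i.1.2.2) 0 (Matrix.specialUnitaryGroup (Fin 2) ℂ)), RegPr i.1.1 i.1.2.1 i.1.2.2 (α L) U₀ →
      ∃ H : (PBond (i.1.1.P i.1.2.1) 0 → Matrix (Fin 2) (Fin 2) ℂ) →ₗ[ℂ] (PBond (i.1.1.P i.1.2.2) 0 → Matrix (Fin 2) (Fin 2) ℂ),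
        (∀ Y, QTwS i.1.1 i.1.2.1 i.1.2.2 i.2.2.le U₀ (H Y) = Y) ∧ (∀ Y, IsLandauPrintS i.1.1 i.1.2.1 i.1.2.2 i.2.2.le (c₀ L) (cB L) U₀ (H Y)) ∧
        (∀ Y, ‖H Y‖ ≤ BH L * eta i.1.1 i.1.2.1 i.1.2.2 * ‖Y‖) ∧
        (∀ Y, (∀ c, star (Y c) = -Y c ∧ (Y c).trace = 0) → ∀ b', star (H Y b') = -H Y b' ∧ (H Y b').trace = 0))
    -- the radius `e L` of the witness ∕ window theorems and the two L-only numerals (WF) of W3 ∕ W5 ∕ the witness (replace (WΣ))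
    (ef : ℕ → ℝ) (hef : ∀ L, 1 < L → 0 < ef L)
    (hWe : ∀ L : ℕ, 1 < L → 10 ^ 9 * (L : ℝ) ^ 2 * ef L ≤ 1) (hWε : ∀ L : ℕ, 1 < L → 10 ^ 12 * (L : ℝ) ^ 3 * α L ≤ 1)
    -- the size window linking (CH5EL-twˢ)'s size row to the witness ∕ window radius, and the regularity window of the chart point
    (hMe : ∀ L, 1 < L → M L * (r L + 2 * B₀ L * α L) < ef L)
    (hw137 : ∀ L : ℕ, 1 < L → 10 ^ 7 * (L : ℝ) ^ 3 * (178 * (α L + ef L)) ≤ 1)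
    -- (CH47-twˢ) IS A THEOREM here (✓`Prop7CmapTwSymInputs.chart47twS_of_regPr_eta`): Prop. 3 for the chart of record at `C₂ := 40M₀ˢ∕(e·η)²`, `M₀ˢ = 6(2e + 2700Lε₀)`, radius `η·ε′`; its two η-free windows are displayed
    (ε' : ℕ → ℝ) (hBH0 : ∀ L : ℕ, 1 < L → 0 ≤ BH L)
    (hq47 : ∀ L : ℕ, 1 < L → 9 * (40 * (2 * (3 * (2 * ef L + 2700 * (L : ℝ) * α L))) / ef L ^ 2) * BH L * ε' L < 1)
    (hR6 : ∀ L : ℕ, 1 < L → 6 * ε' L ≤ ef L)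
    -- (102)-twS «Q𝔊 = 0» and (129)-twS «QH₁ = id» for print's `Q(U₀) = η·(QTwS U₀ ∘ ι)`, read through the (115)-space dictionary `ι` (DISPLAYED, N06-class rows about the opaque letters)
    (h102 : ∀ (L : ℕ), 1 < L → ∀ (i : Idx L) (U₀ : GaugeField (i.1.1.P i.1.2.2) 0 (Matrix.specialUnitaryGroup (Fin 2) ℂ)), RegPr i.1.1 i.1.2.1 i.1.2.2 (α L) U₀ →
      ∀ f : NegSize (i.1.1.L : ℝ) (((i.1.1.L : ℝ)⁻¹) ^ (i.1.2.2 - i.1.2.1)) (fun _ : Bond 3 (periodsT3 i.1.1 i.1.2.2) => i.1.2.2 - i.1.2.1) 3 (Matrix (Fin 2) (Fin 2) ℂ),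
        QTwS i.1.1 i.1.2.1 i.1.2.2 i.2.2.le U₀ (fun b : PBond (i.1.1.P i.1.2.2) 0 => JetSup.equiv _ _ _ (𝒢f L i U₀ f) (bondEquiv i.1.1 i.1.2.2 b)) = 0)
    (h129 : ∀ (L : ℕ), 1 < L → ∀ (i : Idx L) (U₀ : GaugeField (i.1.1.P i.1.2.2) 0 (Matrix.specialUnitaryGroup (Fin 2) ℂ)), RegPr i.1.1 i.1.2.1 i.1.2.2 (α L) U₀ →
      ∀ B : PBond (i.1.1.P i.1.2.1) 0 → Matrix (Fin 2) (Fin 2) ℂ,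
        QTwS i.1.1 i.1.2.1 i.1.2.2 i.2.2.le U₀ (fun b : PBond (i.1.1.P i.1.2.2) 0 => JetSup.equiv _ _ _ (H₁f L i U₀ B) (bondEquiv i.1.1 i.1.2.2 b)) =
          fun c => (((eta i.1.1 i.1.2.1 i.1.2.2 : ℝ) : ℂ))⁻¹ • B c)
    -- (102)-L «R_S D*𝔊 = 0» and (129)-L «R_S D*H₁ = 0» ((3.124)-S) in the projected form `IsLandauPrintS` (d), read through `ι` (DISPLAYED; definitional for the S suppliers)
    (h102L : ∀ (L : ℕ), 1 < L → ∀ (i : Idx L) (U₀ : GaugeField (i.1.1.P i.1.2.2) 0 (Matrix.specialUnitaryGroup (Fin 2) ℂ)), RegPr i.1.1 i.1.2.1 i.1.2.2 (α L) U₀ →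
      ∀ f : NegSize (i.1.1.L : ℝ) (((i.1.1.L : ℝ)⁻¹) ^ (i.1.2.2 - i.1.2.1)) (fun _ : Bond 3 (periodsT3 i.1.1 i.1.2.2) => i.1.2.2 - i.1.2.1) 3 (Matrix (Fin 2) (Fin 2) ℂ),
        IsLandauPrintS i.1.1 i.1.2.1 i.1.2.2 i.2.2.le (c₀ L) (cB L) U₀ (fun b : PBond (i.1.1.P i.1.2.2) 0 => JetSup.equiv _ _ _ (𝒢f L i U₀ f) (bondEquiv i.1.1 i.1.2.2 b)))
    (h129L : ∀ (L : ℕ), 1 < L → ∀ (i : Idx L) (U₀ : GaugeField (i.1.1.P i.1.2.2) 0 (Matrix.specialUnitaryGroup (Fin 2) ℂ)), RegPr i.1.1 i.1.2.1 i.1.2.2 (α L) U₀ →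
      ∀ B : PBond (i.1.1.P i.1.2.1) 0 → Matrix (Fin 2) (Fin 2) ℂ,
        IsLandauPrintS i.1.1 i.1.2.1 i.1.2.2 i.2.2.le (c₀ L) (cB L) U₀ (fun b : PBond (i.1.1.P i.1.2.2) 0 => JetSup.equiv _ _ _ (H₁f L i U₀ B) (bondEquiv i.1.1 i.1.2.2 b)))
    -- the chart-radius window (exponent scale): print's `A′ = A₁ + H₁B` of (103) lies in the `ε₃`-ball of Prop. 3-tw, `η(r + 2B₀α) ≤ ε₃`
    (hrε : ∀ L : ℕ, 1 < L → r L + 2 * B₀ L * α L ≤ ε' L)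
    -- (R-H₁) the letter `H₁(U₀)` is REAL: Hermitian-traceless data ↦ Hermitian-traceless-valued (115)-fields (DISPLAYED, N06-class clause on the `norm_H₁` letter)
    (hH₁R : ∀ (L : ℕ), 1 < L → ∀ (i : Idx L) (U₀ : GaugeField (i.1.1.P i.1.2.2) 0 (Matrix.specialUnitaryGroup (Fin 2) ℂ)), RegPr i.1.1 i.1.2.1 i.1.2.2 (α L) U₀ →
      ∀ B : PBond (i.1.1.P i.1.2.1) 0 → Matrix (Fin 2) (Fin 2) ℂ, (∀ c, (B c).IsHermitian ∧ (B c).trace = 0) →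
        ∀ b' : PBond (i.1.1.P i.1.2.2) 0, (JetSup.equiv _ _ _ (H₁f L i U₀ B) (bondEquiv i.1.1 i.1.2.2 b')).IsHermitian ∧
          (JetSup.equiv _ _ _ (H₁f L i U₀ B) (bondEquiv i.1.1 i.1.2.2 b')).trace = 0)
    -- (R-𝒢) the letter `𝔊(U₀)` is REAL: Hermitian-traceless (−3)-data ↦ Hermitian-traceless (115)-fields (DISPLAYED, N06-class clause on the `norm_G` letter)
    (h𝒢R : ∀ (L : ℕ), 1 < L → ∀ (i : Idx L) (U₀ : GaugeField (i.1.1.P i.1.2.2) 0 (Matrix.specialUnitaryGroup (Fin 2) ℂ)), RegPr i.1.1 i.1.2.1 i.1.2.2 (α L) U₀ →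
      ∀ f : NegSize (i.1.1.L : ℝ) (((i.1.1.L : ℝ)⁻¹) ^ (i.1.2.2 - i.1.2.1)) (fun _ : Bond 3 (periodsT3 i.1.1 i.1.2.2) => i.1.2.2 - i.1.2.1) 3 (Matrix (Fin 2) (Fin 2) ℂ),
        (∀ b, (NegSup.equiv _ _ f b).IsHermitian ∧ (NegSup.equiv _ _ f b).trace = 0) →
        ∀ b, (JetSup.equiv _ _ _ (𝒢f L i U₀ f) b).IsHermitian ∧ (JetSup.equiv _ _ _ (𝒢f L i U₀ f) b).trace = 0)
    -- (R-W) the letter `(δ∕δA′)V` is REAL on its ball: Hermitian-traceless (115)-fields ↦ Hermitian-traceless (−3)-data (DISPLAYED, P4-class clause on the `prop4` letter)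
    (hWR : ∀ (L : ℕ), 1 < L → ∀ (i : Idx L) (U₀ : GaugeField (i.1.1.P i.1.2.2) 0 (Matrix.specialUnitaryGroup (Fin 2) ℂ)), RegPr i.1.1 i.1.2.1 i.1.2.2 (α L) U₀ →
      ∀ A : Space115 (i.1.1.L : ℝ) (((i.1.1.L : ℝ)⁻¹) ^ (i.1.2.2 - i.1.2.1)) (fun _ : Bond 3 (periodsT3 i.1.1 i.1.2.2) => i.1.2.2 - i.1.2.1)
          (fun _ : Bond 3 (periodsT3 i.1.1 i.1.2.2) × Fin 3 => i.1.2.2 - i.1.2.1) (nabla115 (((i.1.1.L : ℝ)⁻¹) ^ (i.1.2.2 - i.1.2.1)) (bgOfCfg i.1.1 i.1.2.2 U₀)),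
        ‖A‖ < a₃ L → (∀ b, (JetSup.equiv _ _ _ A b).IsHermitian ∧ (JetSup.equiv _ _ _ A b).trace = 0) →
        ∀ b, (NegSup.equiv _ _ (Wf L i U₀ A) b).IsHermitian ∧ (NegSup.equiv _ _ (Wf L i U₀ A) b).trace = 0)
    -- the three `L`-only windows putting `ε₄ := r` in Prop. 6's uniqueness regime (118)∕(121)
    (hrα : ∀ L : ℕ, 1 < L → 2 * B₀ L * α L ≤ r L) (hr4 : ∀ L : ℕ, 1 < L → 4 * r L ≤ a₃ L) (hr16 : ∀ L : ℕ, 1 < L → 16 * B₀ L * C₄ L * r L ≤ 1)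
    -- (CH5EL-twˢ)‴: (112) ∘ (123)–(140) ((19)-size) ∘ E–L (at the `NormS`-representatives) at print's `A′ = A₁ + H₁B` in the exponent scale `iη·(ι A₁ + ι(H₁B))`, for the REAL `H` of (45)–(46)-twˢ, chart remainder `Dfix (CmapTwS U₀)` (DISPLAYED, XL; no (20), (21), datum, NO REALITY — Prop. 5's «X is 𝔤-valued» is now proved)
    (hXtw''' : ∀ (L : ℕ), 1 < L → ∀ (i : Idx L) (ε₁ : ℝ) (V : GaugeField (i.1.1.P i.1.2.1) 0 (Matrix.specialUnitaryGroup (Fin 2) ℂ))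
      (U₀ : GaugeField (i.1.1.P i.1.2.2) 0 (Matrix.specialUnitaryGroup (Fin 2) ℂ))
      (H : (PBond (i.1.1.P i.1.2.1) 0 → Matrix (Fin 2) (Fin 2) ℂ) →ₗ[ℂ] (PBond (i.1.1.P i.1.2.2) 0 → Matrix (Fin 2) (Fin 2) ℂ)), 0 < ε₁ → PlaqSmall ε₁ V →
      RegPr i.1.1 i.1.2.1 i.1.2.2 ((L : ℝ) ^ 3 * (3 * (L : ℝ)) * ε₁) U₀ → CloseAvg i.1.1 i.1.2.1 i.1.2.2 i.2.2.le ((L : ℝ) ^ 3 * ε₁) V U₀ → (L : ℝ) ^ 3 * (3 * (L : ℝ)) * ε₁ ≤ α L →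
      (∀ Y, QTwS i.1.1 i.1.2.1 i.1.2.2 i.2.2.le U₀ (H Y) = Y) → (∀ Y, IsLandauPrintS i.1.1 i.1.2.1 i.1.2.2 i.2.2.le (c₀ L) (cB L) U₀ (H Y)) →
      (∀ Y, ‖H Y‖ ≤ BH L * eta i.1.1 i.1.2.1 i.1.2.2 * ‖Y‖) →
      (∀ Y, (∀ c, star (Y c) = -Y c ∧ (Y c).trace = 0) → ∀ b', star (H Y b') = -H Y b' ∧ (H Y b').trace = 0) → Chart47T3twS i.1.1 i.1.2.1 i.1.2.2 i.2.2.le (40 * (2 * (3 * (2 * ef L + 2700 * (i.1.1.L : ℝ) * α L))) / (ef L * eta i.1.1 i.1.2.1 i.1.2.2) ^ 2) (eta i.1.1 i.1.2.1 i.1.2.2 * ε' L) U₀ H →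
      ∀ A₁ : Space115 (i.1.1.L : ℝ) (((i.1.1.L : ℝ)⁻¹) ^ (i.1.2.2 - i.1.2.1)) (fun _ : Bond 3 (periodsT3 i.1.1 i.1.2.2) => i.1.2.2 - i.1.2.1)
          (fun _ : Bond 3 (periodsT3 i.1.1 i.1.2.2) × Fin 3 => i.1.2.2 - i.1.2.1) (nabla115 (((i.1.1.L : ℝ)⁻¹) ^ (i.1.2.2 - i.1.2.1)) (bgOfCfg i.1.1 i.1.2.2 U₀)),
        ‖A₁‖ < r L →
        A₁ + 𝒢f L i U₀ (Jcur (bgOfCfg i.1.1 i.1.2.2 U₀)) + 𝒢f L i U₀ (Wf L i U₀ (A₁ + H₁f L i U₀ (fun c : PBond (i.1.1.P i.1.2.1) 0 =>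
          (-Complex.I) • mlog (((V c : Matrix.specialUnitaryGroup (Fin 2) ℂ) : Matrix (Fin 2) (Fin 2) ℂ)
            * star ((descendTo i.1.1 ℰp i.1.2.1 i.1.2.2 i.2.2.le U₀ c : Matrix.specialUnitaryGroup (Fin 2) ℂ) : Matrix (Fin 2) (Fin 2) ℂ))))) = 0 →
        ∃ X : PBond (i.1.1.P i.1.2.2) 0 → Matrix (Fin 2) (Fin 2) ℂ,
          (((eta i.1.1 i.1.2.1 i.1.2.2 : ℝ) : ℂ) * Complex.I) • ((fun b : PBond (i.1.1.P i.1.2.2) 0 => JetSup.equiv _ _ _ A₁ (bondEquiv i.1.1 i.1.2.2 b))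
              + (fun b : PBond (i.1.1.P i.1.2.2) 0 => JetSup.equiv _ _ _ (H₁f L i U₀ (fun c : PBond (i.1.1.P i.1.2.1) 0 =>
          (-Complex.I) • mlog (((V c : Matrix.specialUnitaryGroup (Fin 2) ℂ) : Matrix (Fin 2) (Fin 2) ℂ)
            * star ((descendTo i.1.1 ℰp i.1.2.1 i.1.2.2 i.2.2.le U₀ c : Matrix.specialUnitaryGroup (Fin 2) ℂ) : Matrix (Fin 2) (Fin 2) ℂ)))) (bondEquiv i.1.1 i.1.2.2 b)))
            - H (Dfix (CmapTwS i.1.1 i.1.2.1 i.1.2.2 i.2.2.le U₀) H (40 * (2 * (3 * (2 * ef L + 2700 * (i.1.1.L : ℝ) * α L))) / (ef L * eta i.1.1 i.1.2.1 i.1.2.2) ^ 2)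
              ((((eta i.1.1 i.1.2.1 i.1.2.2 : ℝ) : ℂ) * Complex.I) • ((fun b : PBond (i.1.1.P i.1.2.2) 0 => JetSup.equiv _ _ _ A₁ (bondEquiv i.1.1 i.1.2.2 b))
              + (fun b : PBond (i.1.1.P i.1.2.2) 0 => JetSup.equiv _ _ _ (H₁f L i U₀ (fun c : PBond (i.1.1.P i.1.2.1) 0 =>
          (-Complex.I) • mlog (((V c : Matrix.specialUnitaryGroup (Fin 2) ℂ) : Matrix (Fin 2) (Fin 2) ℂ)
            * star ((descendTo i.1.1 ℰp i.1.2.1 i.1.2.2 i.2.2.le U₀ c : Matrix.specialUnitaryGroup (Fin 2) ℂ) : Matrix (Fin 2) (Fin 2) ℂ)))) (bondEquiv i.1.1 i.1.2.2 b)))))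
            = (fun b => Complex.I • X b) ∧
          nMax19 i.1.1 i.1.2.1 i.1.2.2 U₀ X ≤ M L * (‖A₁‖ + ‖H₁f L i U₀ (fun c : PBond (i.1.1.P i.1.2.1) 0 =>
          (-Complex.I) • mlog (((V c : Matrix.specialUnitaryGroup (Fin 2) ℂ) : Matrix (Fin 2) (Fin 2) ℂ)
            * star ((descendTo i.1.1 ℰp i.1.2.1 i.1.2.2 i.2.2.le U₀ c : Matrix.specialUnitaryGroup (Fin 2) ℂ) : Matrix (Fin 2) (Fin 2) ℂ)))‖) ∧
          (∀ u : GaugeTransf (i.1.1.P i.1.2.2) 0 (Matrix.specialUnitaryGroup (Fin 2) ℂ), NormS i.1.1 i.1.2.1 i.1.2.2 i.2.2.le U₀ X (expHermField X) u →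
            GaugeField.gaugeAct u (emb15 U₀ (expHermField X)) ∈ fibre i.1.1 ℰp i.1.2.1 i.1.2.2 i.2.2.le V →
            ∀ γ : ℝ → GaugeField (i.1.1.P i.1.2.2) 0 (Matrix.specialUnitaryGroup (Fin 2) ℂ), γ 0 = GaugeField.gaugeAct u (emb15 U₀ (expHermField X)) →
              (∀ t, γ t ∈ fibre i.1.1 ℰp i.1.2.1 i.1.2.2 i.2.2.le V) →
              (∀ b, DifferentiableAt ℝ (fun t => ((γ t b : Matrix.specialUnitaryGroup (Fin 2) ℂ) : Matrix (Fin 2) (Fin 2) ℂ)) 0) →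
                deriv (fun t => wilsonAction4 (γ t)) 0 = 0))
    -- the slice at the critical background `W`, OPAQUE (print's linear Landau slice `{QA′ = 0, RD*A′ = 0}` at background `W` read through (47), SIZES INCLUDED; the α-P lane's letter)
    (Tsl : ∀ (L : ℕ) (i : Idx L), GaugeField (i.1.1.P i.1.2.2) 0 (Matrix.specialUnitaryGroup (Fin 2) ℂ) → Set (PBond (i.1.1.P i.1.2.2) 0 → Matrix (Fin 2) (Fin 2) ℂ))
    -- (ii-a) CHART_W at the critical background `W = (e^{iX}U₀)^u`: every admissible competitor has the action of a chart point `e^{iD}W`, `D` in the slice `Tsl L i W` (all size information lives in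
    -- the opaque slice letter) — [Balaban1985RegularSpaces] Thm 2 + (47) at background `W` + gauge invariance of (5), DISPLAYED
    (hChartW : ∀ (L : ℕ), 1 < L → ∀ (i : Idx L) (ε₁ ε₄ : ℝ) (V : GaugeField (i.1.1.P i.1.2.1) 0 (Matrix.specialUnitaryGroup (Fin 2) ℂ))
      (U₀ : GaugeField (i.1.1.P i.1.2.2) 0 (Matrix.specialUnitaryGroup (Fin 2) ℂ)) (X : PBond (i.1.1.P i.1.2.2) 0 → Matrix (Fin 2) (Fin 2) ℂ)
      (u : GaugeTransf (i.1.1.P i.1.2.2) 0 (Matrix.specialUnitaryGroup (Fin 2) ℂ)) (W : GaugeField (i.1.1.P i.1.2.2) 0 (Matrix.specialUnitaryGroup (Fin 2) ℂ)),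
      0 < ε₁ → ε₄ ≤ 1 / 4 → ε₄ ≤ aW L → (L : ℝ) ^ 3 * (3 * (L : ℝ)) * ε₁ ≤ ε₄ → PlaqSmall ε₁ V → RegPr i.1.1 i.1.2.1 i.1.2.2 ((L : ℝ) ^ 3 * (3 * (L : ℝ)) * ε₁) U₀ →
      CloseAvg i.1.1 i.1.2.1 i.1.2.2 i.2.2.le ((L : ℝ) ^ 3 * ε₁) V U₀ → (∀ b : PBond (i.1.1.P i.1.2.2) 0, (X b).IsHermitian ∧ Matrix.trace (X b) = 0) →
      nMax19 i.1.1 i.1.2.1 i.1.2.2 U₀ X < ε₄ → AvgCondPrintS i.1.1 i.1.2.1 i.1.2.2 i.2.2.le V U₀ X → IsLandauPrintS i.1.1 i.1.2.1 i.1.2.2 i.2.2.le (c₀ L) (cB L) U₀ X →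
      NormS i.1.1 i.1.2.1 i.1.2.2 i.2.2.le U₀ X (expHermField X) u → W = GaugeField.gaugeAct u (emb15 U₀ (expHermField X)) →
      W ∈ fibre i.1.1 ℰp i.1.2.1 i.1.2.2 i.2.2.le V →
      (∀ γ : ℝ → GaugeField (i.1.1.P i.1.2.2) 0 (Matrix.specialUnitaryGroup (Fin 2) ℂ), γ 0 = W → (∀ t, γ t ∈ fibre i.1.1 ℰp i.1.2.1 i.1.2.2 i.2.2.le V) →
        (∀ b, DifferentiableAt ℝ (fun t => ((γ t b : Matrix.specialUnitaryGroup (Fin 2) ℂ) : Matrix (Fin 2) (Fin 2) ℂ)) 0) →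
          deriv (fun t => wilsonAction4 (γ t)) 0 = 0) →
      ∀ X' : PBond (i.1.1.P i.1.2.2) 0 → Matrix (Fin 2) (Fin 2) ℂ, nMax19 i.1.1 i.1.2.1 i.1.2.2 U₀ X' < ε₄ →
        (∀ b : PBond (i.1.1.P i.1.2.2) 0, (X' b).IsHermitian ∧ Matrix.trace (X' b) = 0) →
          AvgCondPrint i.1.1 i.1.2.1 i.1.2.2 i.2.2.le V U₀ X' → IsLandauPrint i.1.1 i.1.2.1 i.1.2.2 U₀ X' →
            ∃ D ∈ Tsl L i W, (∀ b : PBond (i.1.1.P i.1.2.2) 0, (D b).IsHermitian ∧ Matrix.trace (D b) = 0) ∧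
              wilsonAction4 (emb15 U₀ (expHermField X')) = wilsonAction4 (emb15 W (expHermField D)))
    -- (ii-b) LOCMIN_W: `W` is a minimum of the action along the charted slice — (141)–(142) at the critical background: first variation = 0 on the linear slice, second variation
    -- `½⟨A′, Δ₁A′⟩` positive definite, third order absorbed (DISPLAYED; the α-P lane's row: TAYLOR ∧ EL_W ∧ HESS_W in their scale-aware shapes ⟹ LOCMIN_W)
    (hLocW : ∀ (L : ℕ), 1 < L → ∀ (i : Idx L) (ε₁ ε₄ : ℝ) (V : GaugeField (i.1.1.P i.1.2.1) 0 (Matrix.specialUnitaryGroup (Fin 2) ℂ))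
      (U₀ : GaugeField (i.1.1.P i.1.2.2) 0 (Matrix.specialUnitaryGroup (Fin 2) ℂ)) (X : PBond (i.1.1.P i.1.2.2) 0 → Matrix (Fin 2) (Fin 2) ℂ)
      (u : GaugeTransf (i.1.1.P i.1.2.2) 0 (Matrix.specialUnitaryGroup (Fin 2) ℂ)) (W : GaugeField (i.1.1.P i.1.2.2) 0 (Matrix.specialUnitaryGroup (Fin 2) ℂ)),
      0 < ε₁ → ε₄ ≤ 1 / 4 → ε₄ ≤ aW L → (L : ℝ) ^ 3 * (3 * (L : ℝ)) * ε₁ ≤ ε₄ → PlaqSmall ε₁ V → RegPr i.1.1 i.1.2.1 i.1.2.2 ((L : ℝ) ^ 3 * (3 * (L : ℝ)) * ε₁) U₀ →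
      CloseAvg i.1.1 i.1.2.1 i.1.2.2 i.2.2.le ((L : ℝ) ^ 3 * ε₁) V U₀ → (∀ b : PBond (i.1.1.P i.1.2.2) 0, (X b).IsHermitian ∧ Matrix.trace (X b) = 0) →
      nMax19 i.1.1 i.1.2.1 i.1.2.2 U₀ X < ε₄ → AvgCondPrintS i.1.1 i.1.2.1 i.1.2.2 i.2.2.le V U₀ X → IsLandauPrintS i.1.1 i.1.2.1 i.1.2.2 i.2.2.le (c₀ L) (cB L) U₀ X →
      NormS i.1.1 i.1.2.1 i.1.2.2 i.2.2.le U₀ X (expHermField X) u → W = GaugeField.gaugeAct u (emb15 U₀ (expHermField X)) →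
      W ∈ fibre i.1.1 ℰp i.1.2.1 i.1.2.2 i.2.2.le V →
      (∀ γ : ℝ → GaugeField (i.1.1.P i.1.2.2) 0 (Matrix.specialUnitaryGroup (Fin 2) ℂ), γ 0 = W → (∀ t, γ t ∈ fibre i.1.1 ℰp i.1.2.1 i.1.2.2 i.2.2.le V) →
        (∀ b, DifferentiableAt ℝ (fun t => ((γ t b : Matrix.specialUnitaryGroup (Fin 2) ℂ) : Matrix (Fin 2) (Fin 2) ℂ)) 0) →
          deriv (fun t => wilsonAction4 (γ t)) 0 = 0) →
      ∀ D ∈ Tsl L i W, (∀ b : PBond (i.1.1.P i.1.2.2) 0, (D b).IsHermitian ∧ Matrix.trace (D b) = 0) →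
        wilsonAction4 W ≤ wilsonAction4 (emb15 W (expHermField D)))
    -- (T2) the [B8] Thm 2 sockets AT THE SETUP-TORUS OBJECTS (`Thm2SetupSUAt`, rider dropped), one `(B₁, c₁)` per `L` (v3.2ˢ currency)
    (hThm2S : ∀ (L : ℕ), 1 < L → ∃ B₁ c₁ : ℝ, 0 < B₁ ∧ 0 < c₁ ∧ ∀ (F : T3Family), F.L = L → ∀ (n K : ℕ), n < K →
      ∃ (β₀ B₂ : ℝ) (len : B7Prop1Explicit.Site (F.P K).d → ℝ),
        Thm2SetupSUAt (F.P K) 2 (K - n) (eta F n K) β₀ B₁ B₂ c₁ len (fun _ => True)) :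
    ∀ (L : ℕ), 1 < L → ∀ (B₃ : ℝ), 4 < B₃ → ∃ a₁' O₁ : ℝ, 0 < a₁' ∧ 1 ≤ O₁ ∧
    ∀ (F : T3Family), F.L = L → ∀ (n K : ℕ) (hnK : n < K) (ε₁ : ℝ), 0 < ε₁ →
      ∀ V : GaugeField (F.P n) 0 (Matrix.specialUnitaryGroup (Fin 2) ℂ), PlaqSmall ε₁ V →
        ∀ U₀ : GaugeField (F.P K) 0 (Matrix.specialUnitaryGroup (Fin 2) ℂ), RegPr F n K ((L : ℝ) ^ 3 * B₃ * ε₁) U₀ → U₀ ∈ fibre F ℰp n K hnK.le V →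
          ε₁ ≤ a₁' → ∃ U ∈ regFibrePr F n K hnK.le (O₁ * (L : ℝ) ^ 3 * B₃ * ε₁) V,
            IsMinOn (fun W : GaugeField (F.P K) 0 (Matrix.specialUnitaryGroup (Fin 2) ℂ) => wilsonAction4 W)
              (regFibrePr F n K hnK.le (O₁ * (L : ℝ) ^ 3 * B₃ * ε₁) V) U := by
  -- `stubEX_of_displayedRows_wWS` at `Lan := IsLandauPrintS (c₀ L) (cB L)`, chart of record, `β := Λ_k`, `B := Bsym`; two rows to discharge: (B20) and CHART-112ˢ ((R-A₁) by `hA₁R_of_letterReality`)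
  refine stubEX_of_displayedRows_wWS
    (fun (L : ℕ) (i : Idx L) (U₀ : GaugeField (i.1.1.P i.1.2.2) 0 (Matrix.specialUnitaryGroup (Fin 2) ℂ)) (X : PBond (i.1.1.P i.1.2.2) 0 → Matrix (Fin 2) (Fin 2) ℂ) =>
      IsLandauPrintS i.1.1 i.1.2.1 i.1.2.2 i.2.2.le (c₀ L) (cB L) U₀ X)
    (fun L i => periodsT3 i.1.1 i.1.2.2) (fun L i => siteEquiv i.1.1 i.1.2.2) (fun L i x μ => siteEquiv_shiftEquiv i.1.1 i.1.2.2 x μ)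
    B₀ C₄ a₃ α r M aW hB₀ hC₄ ha₃ hα hr hM haW 𝒢f Wf (fun L i => PBond (i.1.1.P i.1.2.1) 0) H₁f
    (fun L i V U₀ => fun c : PBond (i.1.1.P i.1.2.1) 0 =>
      (-Complex.I) • mlog (((V c : Matrix.specialUnitaryGroup (Fin 2) ℂ) : Matrix (Fin 2) (Fin 2) ℂ)
        * star ((descendTo i.1.1 ℰp i.1.2.1 i.1.2.2 i.2.2.le U₀ c : Matrix.specialUnitaryGroup (Fin 2) ℂ) : Matrix (Fin 2) (Fin 2) ℂ)))
    Tsl norm_G prop4 norm_H₁ ?_ ?_ hChartW hLocW hThm2S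
  · -- (B20) DISCHARGED at the letter `Bsym` (★w4-19200 g2), window `L³ε₁ ≤ α∕(3L) ≤ 1∕48` from WS `2α ≤ ⅛`
    intro L hL i ε₁ V U₀ hε₁ _hV _hreg hclose hαe
    have hFL' : (i.1.1.L : ℝ) = (L : ℝ) := by exact_mod_cast i.2.1
    have hL1 : (1 : ℝ) ≤ (L : ℝ) := by exact_mod_cast hL.le
    have s3 : 2 * α L ≤ 1 / 8 :=
      (windows_of_W (by rw [← hFL']; exact three_le_memberL i) (hα L hL).le (hef L hL).le (hWe L hL) (hWε L hL)).1
    have hwin : (i.1.1.L : ℝ) ^ 3 * ε₁ ≤ 1 / 2 := by rw [hFL']; exact (windows_of_admissible hL1 hε₁.le hαe s3).1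
    have hclose' : CloseAvg i.1.1 i.1.2.1 i.1.2.2 i.2.2.le ((i.1.1.L : ℝ) ^ 3 * ε₁) V U₀ := by rw [hFL']; exact hclose
    have hB := bound20_symLog_of_closeAvg i.1.1 i.2.2.le hε₁ hwin V U₀ hclose'
    have hrad : (i.1.1.L : ℝ) ^ 3 * ε₁ = (L : ℝ) ^ 3 * ε₁ := by rw [hFL']
    rw [hrad] at hB
    exact hB
  · -- CHART-112ˢ DISCHARGED: (46)-twˢ ∃H, Prop. 3 for the chart of record (W5), the witness row, the window (W3), the member-level knit `hChart_of_piecesTwS`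
    intro L hL i ε₁ V U₀ hε₁ hV hreg hclose hαe A₁ hA₁ hsol
    have hFL' : (i.1.1.L : ℝ) = (L : ℝ) := by exact_mod_cast i.2.1
    have hL0 : (0 : ℝ) < (L : ℝ) := by exact_mod_cast (show 0 < L by omega)
    have hL1 : (1 : ℝ) ≤ (L : ℝ) := by exact_mod_cast hL.le
    have hL3 : (3 : ℝ) ≤ (L : ℝ) := by rw [← hFL']; exact three_le_memberL i
    obtain ⟨s3, s4⟩ := windows_of_W hL3 (hα L hL).le (hef L hL).le (hWe L hL) (hWε L hL)
    have hWe' : 10 ^ 9 * (i.1.1.L : ℝ) ^ 2 * ef L ≤ 1 := by rw [hFL']; exact hWe L hL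
    have hWε' : 10 ^ 12 * (i.1.1.L : ℝ) ^ 3 * α L ≤ 1 := by rw [hFL']; exact hWε L hL
    -- the background at the window radius `α L`
    have hregα : RegPr i.1.1 i.1.2.1 i.1.2.2 (α L) U₀ := regPr_mono i.1.1 hαe hreg
    -- (46)-twˢ and Prop. 3 at this background
    obtain ⟨H, hQH, h45H, hHB, hHR⟩ := h46tw L hL i U₀ hregα
    -- (CH47-twˢ) DISCHARGED: ★w4-20520 g3's W5 `chart47twS_of_regPr_eta` in (WF) `hWe`∕`hWε`, (W47q), (W47R)
    have hα0 : 0 < α L := hα L hL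
    have he0 : 0 < ef L := hef L hL
    have hw137' : 10 ^ 7 * (i.1.1.L : ℝ) ^ 3 * (178 * (α L + ef L)) ≤ 1 := by rw [hFL']; exact hw137 L hL
    have h47 : Chart47T3twS i.1.1 i.1.2.1 i.1.2.2 i.2.2.le (40 * (2 * (3 * (2 * ef L + 2700 * (i.1.1.L : ℝ) * α L))) / (ef L * eta i.1.1 i.1.2.1 i.1.2.2) ^ 2)
        (eta i.1.1 i.1.2.1 i.1.2.2 * ε' L) U₀ H := by
      have hq : 9 * (40 * (2 * (3 * (2 * ef L + 2700 * (i.1.1.L : ℝ) * α L))) / ef L ^ 2) * BH L * ε' L < 1 := by rw [hFL']; exact hq47 L hL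
      exact chart47twS_of_regPr_eta i.1.1 i.2.2.le hα0 he0 hWe' hWε' U₀ hregα (hBH0 L hL) hHB hq (hR6 L hL)
    -- CHART-ΣS WITNESS (★w5-20520 g4's THEOREM `exists_normS_of_regPr_of_size`; the chart point is printed-regular of radius `178(α + e)` by [Balaban1985RegularSpaces] Prop. 7)
    have hWit' : ∀ X : PBond (i.1.1.P i.1.2.2) 0 → Matrix (Fin 2) (Fin 2) ℂ, (∀ b : PBond (i.1.1.P i.1.2.2) 0, (X b).IsHermitian ∧ Matrix.trace (X b) = 0) →
        nMax19 i.1.1 i.1.2.1 i.1.2.2 U₀ X < ef L →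
        ∃ u : GaugeTransf (i.1.1.P i.1.2.2) 0 (Matrix.specialUnitaryGroup (Fin 2) ℂ), NormS i.1.1 i.1.2.1 i.1.2.2 i.2.2.le U₀ X (expHermField X) u := by
      intro X hX hlt
      have hε₂ : α L + ef L ≤ 1 / 4 := by linarith
      have h19 : In19 i.1.1 i.1.2.1 i.1.2.2 (α L + ef L) U₀ (expHermField X) X := in19_expHermField_of_nMax19_lt hX (hlt.trans_le (by linarith))
      have hU₁ : RegPr i.1.1 i.1.2.1 i.1.2.2 (178 * (α L + ef L)) (emb15 U₀ (expHermField X)) :=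
        regPr_emb15_of_in19 i.1.1 i.1.2.1 i.1.2.2 hε₂ (by linarith) hregα h19
      have hXe : ∀ b : PBond (i.1.1.P i.1.2.2) 0, ‖X b‖ ≤ ef L * eta i.1.1 i.1.2.1 i.1.2.2 := fun b => by
        have h1 := norm_smul_I_le_of_nMax19_lt i.1.1 hlt b
        rwa [norm_smul, Complex.norm_I, one_mul] at h1
      exact exists_normS_of_regPr_of_size i.1.1 i.2.2.le hα0 hWε' (by positivity) hw137' he0.le hWe' hregα hX hXe hU₁
    -- ‖H₁B‖ ≤ 2B₀α from `norm_H₁` ∘ (B20) and `L³·3L·ε₁ ≤ α`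
    have hwin : (i.1.1.L : ℝ) ^ 3 * ε₁ ≤ 1 / 2 := by rw [hFL']; exact (windows_of_admissible hL1 hε₁.le hαe s3).1
    have hclose' : CloseAvg i.1.1 i.1.2.1 i.1.2.2 i.2.2.le ((i.1.1.L : ℝ) ^ 3 * ε₁) V U₀ := by rw [hFL']; exact hclose
    have hB := bound20_symLog_of_closeAvg i.1.1 i.2.2.le hε₁ hwin V U₀ hclose'
    have hH₁B : ‖H₁f L i U₀ (fun c : PBond (i.1.1.P i.1.2.1) 0 =>
        (-Complex.I) • mlog (((V c : Matrix.specialUnitaryGroup (Fin 2) ℂ) : Matrix (Fin 2) (Fin 2) ℂ)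
          * star ((descendTo i.1.1 ℰp i.1.2.1 i.1.2.2 i.2.2.le U₀ c : Matrix.specialUnitaryGroup (Fin 2) ℂ) : Matrix (Fin 2) (Fin 2) ℂ)))‖ ≤ 2 * B₀ L * α L := by
      have h0 := norm_H₁ L hL i _ U₀ hreg hαe (fun c : PBond (i.1.1.P i.1.2.1) 0 =>
        (-Complex.I) • mlog (((V c : Matrix.specialUnitaryGroup (Fin 2) ℂ) : Matrix (Fin 2) (Fin 2) ℂ)
          * star ((descendTo i.1.1 ℰp i.1.2.1 i.1.2.2 i.2.2.le U₀ c : Matrix.specialUnitaryGroup (Fin 2) ℂ) : Matrix (Fin 2) (Fin 2) ℂ)))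
      have hB' : ‖(fun c : PBond (i.1.1.P i.1.2.1) 0 =>
          (-Complex.I) • mlog (((V c : Matrix.specialUnitaryGroup (Fin 2) ℂ) : Matrix (Fin 2) (Fin 2) ℂ)
            * star ((descendTo i.1.1 ℰp i.1.2.1 i.1.2.2 i.2.2.le U₀ c : Matrix.specialUnitaryGroup (Fin 2) ℂ) : Matrix (Fin 2) (Fin 2) ℂ)))‖ ≤ 2 * α L := by
        have h3 : 2 * ((3 : ℝ) * i.1.1.L) * ((i.1.1.L : ℝ) ^ 3 * ε₁) = 2 * ((L : ℝ) ^ 3 * (3 * (L : ℝ)) * ε₁) := by rw [hFL']; ring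
        rw [h3] at hB
        linarith
      calc _ ≤ B₀ L * _ := h0
        _ ≤ B₀ L * (2 * α L) := mul_le_mul_of_nonneg_left hB' (hB₀ L hL).le
        _ = 2 * B₀ L * α L := by ring
    have hMe' : M L * (r L + ‖H₁f L i U₀ (fun c : PBond (i.1.1.P i.1.2.1) 0 =>
        (-Complex.I) • mlog (((V c : Matrix.specialUnitaryGroup (Fin 2) ℂ) : Matrix (Fin 2) (Fin 2) ℂ)
          * star ((descendTo i.1.1 ℰp i.1.2.1 i.1.2.2 i.2.2.le U₀ c : Matrix.specialUnitaryGroup (Fin 2) ℂ) : Matrix (Fin 2) (Fin 2) ℂ)))‖) < ef L := by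
      have : M L * (r L + ‖H₁f L i U₀ (fun c : PBond (i.1.1.P i.1.2.1) 0 =>
        (-Complex.I) • mlog (((V c : Matrix.specialUnitaryGroup (Fin 2) ℂ) : Matrix (Fin 2) (Fin 2) ℂ)
          * star ((descendTo i.1.1 ℰp i.1.2.1 i.1.2.2 i.2.2.le U₀ c : Matrix.specialUnitaryGroup (Fin 2) ℂ) : Matrix (Fin 2) (Fin 2) ℂ)))‖) ≤ M L * (r L + 2 * B₀ L * α L) :=
        mul_le_mul_of_nonneg_left (by linarith) (hM L hL).le
      exact lt_of_le_of_lt this (hMe L hL)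
    -- the numeric windows of the member-level knit
    obtain ⟨-, hb1, hα16⟩ := windows_of_admissible hL1 hε₁.le hαe s3
    -- the contraction regime of the reality junction in η-form: `9·C₂ˢ·(B_H η)·(η ε′) = 9·(40M₀ˢ∕e²)·B_H·ε′`, `6ηε′ ≤ eη`
    have hηpos : 0 < eta i.1.1 i.1.2.1 i.1.2.2 := T3SectALandauChart.eta_pos i.1.1 i.1.2.1 i.1.2.2
    have hq' : 9 * (40 * (2 * (3 * (2 * ef L + 2700 * (i.1.1.L : ℝ) * α L))) / (ef L * eta i.1.1 i.1.2.1 i.1.2.2) ^ 2)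
        * (BH L * eta i.1.1 i.1.2.1 i.1.2.2) * (eta i.1.1 i.1.2.1 i.1.2.2 * ε' L) < 1 := by
      have hcalc : 9 * (40 * (2 * (3 * (2 * ef L + 2700 * (i.1.1.L : ℝ) * α L))) / (ef L * eta i.1.1 i.1.2.1 i.1.2.2) ^ 2)
          * (BH L * eta i.1.1 i.1.2.1 i.1.2.2) * (eta i.1.1 i.1.2.1 i.1.2.2 * ε' L)
          = 9 * (40 * (2 * (3 * (2 * ef L + 2700 * (i.1.1.L : ℝ) * α L))) / ef L ^ 2) * BH L * ε' L := by
        field_simp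
      rw [hcalc, hFL']; exact hq47 L hL
    have hRε' : 6 * (eta i.1.1 i.1.2.1 i.1.2.2 * ε' L) ≤ ef L * eta i.1.1 i.1.2.1 i.1.2.2 := by nlinarith [hR6 L hL]
    -- (R-B) the pinned datum is Hermitian-traceless: `V·Ū₀* ∈ SU(2)` within `1∕3` of `1` ((14): `L³ε₁ ≤ α∕(3L) ≤ 1∕48`)
    have h13 : (i.1.1.L : ℝ) ^ 3 * ε₁ ≤ 1 / 3 := by
      rw [hFL']
      have h0 : 0 ≤ (L : ℝ) ^ 3 * ε₁ := by positivity
      have h1 : (L : ℝ) ^ 3 * (3 * (L : ℝ)) * ε₁ ≤ 1 / 16 := hαe.trans hα16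
      nlinarith [mul_nonneg h0 (by linarith : (0 : ℝ) ≤ 3 * (L : ℝ) - 1)]
    have hBR := bsym_isHermitian_trace_zero i.1.1 i.2.2.le V U₀ h13 hclose'
    -- (WIN-twˢ) DISCHARGED (★w4-20520 g3's W3 `dbarTwS_window_of_regPr`, ✓p617963) in (WF) `hWe`∕`hWε`
    have hwin : ∀ X : PBond (i.1.1.P i.1.2.2) 0 → Matrix (Fin 2) (Fin 2) ℂ, (∀ b : PBond (i.1.1.P i.1.2.2) 0, (X b).IsHermitian ∧ Matrix.trace (X b) = 0) →
        nMax19 i.1.1 i.1.2.1 i.1.2.2 U₀ X < ef L →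
        ∀ c : PBond (i.1.1.P i.1.2.1) 0, ‖((dbarTwS i.1.1 i.1.2.1 i.1.2.2 i.2.2.le U₀ (fun b => Complex.I • X b) c : (Matrix (Fin 2) (Fin 2) ℂ)ˣ) : Matrix (Fin 2) (Fin 2) ℂ) - 1‖ < 1 :=
      fun X _ hX c => (dbarTwS_window_of_regPr i.1.1 i.2.2.le (hα L hL) (hef L hL) hWe' hWε' U₀ hregα X hX c).2
    exact hChart_of_piecesTwG i.1.1 i.2.2.le (fun X : PBond (i.1.1.P i.1.2.2) 0 → Matrix (Fin 2) (Fin 2) ℂ => IsLandauPrintS i.1.1 i.1.2.1 i.1.2.2 i.2.2.le (c₀ L) (cB L) U₀ X)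
      (hα L hL) hα16 (hef L hL) s4 hb1 hw137' hregα hclose h47 hQH hWit' hwin
      (hXtw_of_split_etaG i.1.1 i.2.2.le _ (h102 L hL i U₀ hregα) (h129 L hL i U₀ hregα) hH₁B
        (mul_le_mul_of_nonneg_left (hrε L hL) (T3SectALandauChart.eta_pos i.1.1 i.1.2.1 i.1.2.2).le)
        -- (21)ˢ DISCHARGED through the generic Landau split at `IsLandauPrintS`: (102)-L, (129)-L and (45) for the chart's `H` (`IsLandauPrintS.add∕.smul`)
        (hXtw'_of_splitG i.1.1 i.2.2.le _ (fun _ _ hX hY => hX.add hY) (fun a _ hX => hX.smul a) (h102L L hL i U₀ hregα) (h129L L hL i U₀ hregα) h45H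
          (hXtw''_of_reality i.1.1 i.2.2.le hα0 he0 hWe' hWε' hregα (mul_nonneg (hBH0 L hL) (T3SectALandauChart.eta_pos i.1.1 i.1.2.1 i.1.2.2).le) hHB hHR hq' hRε'
            (hH₁R L hL i U₀ hregα) hBR hH₁B (mul_le_mul_of_nonneg_left (hrε L hL) (T3SectALandauChart.eta_pos i.1.1 i.1.2.1 i.1.2.2).le)
            (hA₁R_of_letterReality B₀ C₄ a₃ α r hB₀ hC₄ 𝒢f Wf H₁f norm_G prop4 norm_H₁ hWε h𝒢R hWR hrα hr4 hr16 hH₁R L hL i ε₁ V U₀ hε₁ hV hreg hclose hαe)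
            (hXtw''' L hL i ε₁ V U₀ H hε₁ hV hreg hclose hαe hQH h45H hHB hHR h47)))) (hM L hL).le hMe' A₁ hA₁ hsol

end Summit.QuantumFields.YangMills.Theorems.Prop7StubEXOfChartPiecesTwS3S

end
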